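import Literature.NumberTheory.Sieve.FordMaynardFragmentationBridge
import Literature.NumberTheory.Sieve.FordMaynardFragmentationTzero
import HarnessLib

/-!
# Ford–Maynard, Theorem 6.4: (TypeI-f) implies the fragmentation relation

Everything here is PROVED. Fifth file towards Theorem 6.4 of K. Ford, J. Maynard,
*On the theory of prime producing sieves* (arXiv:2407.14368): the implication
(TypeI-f) ⇒ (6.3) (`MemTypeIStar.fragRel`).

By `fragOp_eq_multiSlice` (the bridge file) the fragmentation relation (6.3) at `ξ ∈ ℝ^m` reads
`g(ξ) = ξ₁⋯ξ_m ∑_{1 ≤ k_j ≤ N} multiSlice m k ξ (β ↦ 𝟙[β ≥ η] ∏_j w_{k_j}(β_j) g(β))`,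
`w_k(v) = 𝓛_{1−γ}(v)/(k! ∏ v)`. We prove it (`frag_identity`) by induction on `m`, simultaneously
for all symmetric bounded measurable `g` supported on vectors with entries `≥ η` that satisfy the
one-block identity (Tzero) of the previous file — a class stable under freezing the last
coordinate, `g ↦ g(·, α)` (`oneBlockFrag_snoc`). Peeling the last block of `multiSlice`
(`multiSlice_succ`, innermost integral = last block), the sum over its size `k` of the innermost
integrals is `∑_k (1/k!) ∫_{Δ_k(ξ_m)} 𝓛_{1−γ}(v) g(β', v)/∏v`, which (Tzero) turns into the same
sum with `𝓛_2`; there only `k = 1` survives (`𝓛_2 = 𝟙[dim = 1]` on these slices, Lemma 5.5 (b))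
and gives `g(β', ξ_m)/ξ_m`, i.e. the induction hypothesis for `g(·, ξ_m)`. This is the block by
block replacement `𝓛_∞ → 𝓛_{1−γ}` of §6.1.

## References

* K. Ford, J. Maynard, *On the theory of prime producing sieves*, arXiv:2407.14368 (2024), §6.1
  (proof of Theorem 6.4, (TypeI-f) ⇒ (6.3)). [FordMaynard2024PrimeSieves]
-/

noncomputable section

open MeasureTheory Finset Literature.Combinatorics.Enumerative

namespace Literature.NumberTheory.Sieve.FordMaynard

/-! ### General tools -/

/-- `multiSlice` commutes with finite sums, with hypotheses only on the summands that occur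
(and summand-dependent bounds). [folklore] -/
theorem multiSlice_sum' {ι : Type*} (T : Finset ι) (s : ℕ) (h : Fin s → ℕ) (ψ : Fin s → ℝ)
    (H : ι → (Fin (bsum s h) → ℝ) → ℝ) (hm : ∀ i ∈ T, Measurable (H i)) {C : ι → ℝ}
    (hb : ∀ i ∈ T, ∀ β, |H i β| ≤ C i) :
    multiSlice s h ψ (fun β => ∑ i ∈ T, H i β) = ∑ i ∈ T, multiSlice s h ψ (H i) := by
  classical
  have key := multiSlice_sum T s h ψ (fun i β => if i ∈ T then H i β else 0)
    (fun i => by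
      by_cases hi : i ∈ T
      · simp only [hi, if_true]; exact hm i hi
      · simp only [hi, if_false]; exact measurable_const)
    (C := ∑ i ∈ T, |C i|) (fun i β => by
      by_cases hi : i ∈ T
      · simp only [hi, if_true]
        exact ((hb i hi β).trans (le_abs_self _)).trans
          (Finset.single_le_sum (f := fun i => |C i|) (fun i _ => abs_nonneg _) hi)
      · simp only [hi, if_false, abs_zero]
        exact Finset.sum_nonneg fun i _ => abs_nonneg _)
  have h1 : (fun β => ∑ i ∈ T, if i ∈ T then H i β else 0) = fun β => ∑ i ∈ T, H i β := by
    funext β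
    exact Finset.sum_congr rfl fun i hi => if_pos hi
  rw [h1] at key
  rw [key]
  exact Finset.sum_congr rfl fun i hi => by simp only [hi, if_true]

/-- Splitting a sum over block-size vectors of length `m + 1` into the initial sizes and the last
one. [folklore] -/
theorem sum_piFinset_init_last {m : ℕ} (s : Finset ℕ) (F : (Fin m → ℕ) → ℕ → ℝ) :
    ∑ kv ∈ Fintype.piFinset (fun _ : Fin (m + 1) => s), F (Fin.init kv) (kv (Fin.last m)) =
      ∑ kv' ∈ Fintype.piFinset (fun _ : Fin m => s), ∑ k ∈ s, F kv' k := by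
  rw [← Finset.sum_product']
  refine Finset.sum_nbij' (fun kv => (Fin.init kv, kv (Fin.last m)))
    (fun p => Fin.snoc (α := fun _ => ℕ) p.1 p.2) ?_ ?_ ?_ ?_ ?_
  · intro kv hkv
    simp only [Fintype.mem_piFinset] at hkv
    simp only [Finset.mem_product, Fintype.mem_piFinset]
    exact ⟨fun j => hkv _, hkv _⟩
  · intro p hp
    simp only [Finset.mem_product, Fintype.mem_piFinset] at hp
    simp only [Fintype.mem_piFinset]
    intro j
    refine Fin.lastCases ?_ (fun j' => ?_) j
    · rw [Fin.snoc_last]; exact hp.2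
    · rw [Fin.snoc_castSucc]; exact hp.1 j'
  · intro kv _
    exact Fin.snoc_init_self kv
  · intro p _
    simp only [Fin.init_snoc, Fin.snoc_last]
  · intro kv _
    rfl

/-- Freezing the last coordinate absorbs casts of the first block. [folklore] -/
theorem snoc_comp_cast {a a' : ℕ} (h : a' = a) (β : Fin a → ℝ) (x : ℝ) :
    (Fin.snoc (α := fun _ => ℝ) (β ∘ Fin.cast h) x : Fin (a' + 1) → ℝ) =
      (Fin.snoc (α := fun _ => ℝ) β x : Fin (a + 1) → ℝ) ∘ Fin.cast (congrArg (· + 1) h) := by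
  subst h
  rfl

/-- For `g ∈ 𝒮`: `g(y, u, α) = g(y, α, u)`. [cite: FordMaynard2024PrimeSieves, Definition 6.1] -/
theorem VecFn.IsSymmetric.snoc_append_eq {g : VecFn} (hs : g.IsSymmetric) {r k : ℕ} (y : Fin r → ℝ)
    (u : Fin k → ℝ) (α : ℝ) :
    g (r + k + 1) (Fin.snoc (α := fun _ => ℝ) (Fin.append y u) α) =
      g (r + 1 + k) (Fin.append (Fin.snoc (α := fun _ => ℝ) y α) u) := by
  calc g (r + k + 1) (Fin.snoc (α := fun _ => ℝ) (Fin.append y u) α)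
      = g (r + (k + 1)) (Fin.append y (Fin.snoc (α := fun _ => ℝ) u α)) := by
        rw [← Fin.append_snoc]
        exact VecFn.apply_congr g (by omega) _ _ fun i => rfl
    _ = g (r + (k + 1)) (Fin.append y (Fin.cons α u)) := by
        rw [Fin.snoc_eq_cons_rotate]
        exact hs.append_perm_right y (Fin.cons α u) (finRotate _)
    _ = g (r + 1 + k) (Fin.append (Fin.snoc (α := fun _ => ℝ) y α) u) := by
        rw [Fin.append_right_cons]
        exact VecFn.apply_congr g (by omega) _ _ fun i => rfl

section Forward

variable {η γ : ℝ}

/-! ### The class of functions satisfying (Tzero), and its stability under `g ↦ g(·, α)` -/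

/-- A bound `|g(y,u)/∏u| ≤ G/η^k` for `g` bounded by `G` and supported on vectors with entries
`≥ η > 0`. [folklore] -/
theorem abs_div_prod_le_of_support {g : VecFn} (hη : 0 < η) {Gb : ℝ} (hGb : ∀ n v, |g n v| ≤ Gb)
    (hsupp : ∀ n v, g n v ≠ 0 → ∀ i, η ≤ v i) {r d : ℕ} (y : Fin r → ℝ) (u : Fin d → ℝ) :
    |g (r + d) (Fin.append y u) / ∏ i, u i| ≤ Gb / η ^ d := by
  have hG0 : 0 ≤ Gb := (abs_nonneg _).trans (hGb 0 Fin.elim0)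
  by_cases h : g (r + d) (Fin.append y u) = 0
  · rw [h, zero_div, abs_zero]; positivity
  · have hge := hsupp _ _ h
    have hu : ∀ i, η ≤ u i := fun i => by simpa using hge (Fin.natAdd r i)
    have hprod : η ^ d ≤ ∏ i, u i := by
      calc η ^ d = ∏ _i : Fin d, η := by simp
        _ ≤ ∏ i, u i := Finset.prod_le_prod (fun i _ => hη.le) fun i _ => hu i
    have hpos : 0 < ∏ i, u i := lt_of_lt_of_le (pow_pos hη d) hprod
    rw [abs_div, abs_of_pos hpos, div_le_div_iff₀ hpos (pow_pos hη d)]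
    exact mul_le_mul (hGb _ _) hprod (pow_nonneg hη.le d) hG0

/-- The one-block identity (Tzero) passes from `g` to `g(·, α)` (symmetry of `g`).
[cite: FordMaynard2024PrimeSieves, §6.1 (proof of Theorem 6.4)] -/
theorem oneBlockFrag_snoc {g : VecFn} (hs : g.IsSymmetric) (N : ℕ)
    (hT : ∀ (r : ℕ) (y : Fin r → ℝ) (t : ℝ), ∑ k ∈ Finset.Icc 1 N, (1 / (k.factorial : ℝ)) *
      sliceIntegral k t (fun u => (linnikFn 2 u univ - linnikFn (1 - γ) u univ) *
        (g (r + k) (Fin.append y u) / ∏ i, u i)) = 0)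
    (α : ℝ) (r : ℕ) (y : Fin r → ℝ) (t : ℝ) :
    ∑ k ∈ Finset.Icc 1 N, (1 / (k.factorial : ℝ)) *
      sliceIntegral k t (fun u => (linnikFn 2 u univ - linnikFn (1 - γ) u univ) *
        (g (r + k + 1) (Fin.snoc (α := fun _ => ℝ) (Fin.append y u) α) / ∏ i, u i)) = 0 := by
  rw [← hT (r + 1) (Fin.snoc (α := fun _ => ℝ) y α) t]
  refine Finset.sum_congr rfl fun k _ => ?_
  congr 1
  congr 1
  funext u
  rw [hs.snoc_append_eq y u α]

/-! ### The innermost block: only `k = 1` survives after (Tzero) -/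

/-- **The sum over the size of the last block.** For `g` symmetric bounded measurable, supported
on vectors with entries `≥ η`, satisfying (Tzero) truncated at `N ≥ 1`, for `β' ≥ η` and
`η ≤ α ≤ 1`:
`∑_{k=1}^{N} ∫_{v ∈ Δ_k(α)} 𝟙[β', v ≥ η] W · w_k(v) · g(β', v) dv = W · g(β', α)/α` — by (Tzero)
the weights `𝓛_{1−γ}` may be replaced by `𝓛_2`, and `𝓛_2(v) = 𝟙[k = 1]` on `Δ_k(α)`
(Lemma 5.5 (b)). [cite: FordMaynard2024PrimeSieves, §6.1 (proof of Theorem 6.4)] -/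
theorem inner_block_sum_eq {g : VecFn} (hη : 0 < η) (hgm : ∀ n, Measurable (g n)) {Gb : ℝ}
    (hGb : ∀ n v, |g n v| ≤ Gb) (hsupp : ∀ n v, g n v ≠ 0 → ∀ i, η ≤ v i) {N : ℕ} (hN : 1 ≤ N)
    (hT : ∀ (r : ℕ) (y : Fin r → ℝ) (t : ℝ), ∑ k ∈ Finset.Icc 1 N, (1 / (k.factorial : ℝ)) *
      sliceIntegral k t (fun u => (linnikFn 2 u univ - linnikFn (1 - γ) u univ) *
        (g (r + k) (Fin.append y u) / ∏ i, u i)) = 0)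
    {n : ℕ} (β' : Fin n → ℝ) (hβ' : ∀ t, η ≤ β' t) (W : ℝ) {α : ℝ} (hα : η ≤ α) (hα1 : α ≤ 1) :
    ∑ k ∈ Finset.Icc 1 N, sliceIntegral k α (fun v =>
      if (∀ t, η ≤ β' t) ∧ (∀ i, η ≤ v i) then W * blockWeight γ k v * g (n + k) (Fin.append β' v)
      else 0) = W * (g (n + 1) (Fin.snoc (α := fun _ => ℝ) β' α) / α) := by
  have hαpos : 0 < α := hη.trans_le hα
  have hG0 : 0 ≤ Gb := (abs_nonneg _).trans (hGb 0 Fin.elim0)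
  -- Step 1: the integrands are `W/k! · 𝓛_{1-γ}(v) g(β',v)/∏v`
  have hstep1 : ∀ k, sliceIntegral k α (fun v =>
      if (∀ t, η ≤ β' t) ∧ (∀ i, η ≤ v i) then W * blockWeight γ k v * g (n + k) (Fin.append β' v)
      else 0) = W * ((1 / (k.factorial : ℝ)) * sliceIntegral k α (fun v =>
        linnikFn (1 - γ) v univ * (g (n + k) (Fin.append β' v) / ∏ i, v i))) := by
    intro k
    rw [← sliceIntegral_const_mul, ← sliceIntegral_const_mul]
    congr 1
    funext v
    by_cases hv : ∀ i, η ≤ v i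
    · rw [if_pos ⟨hβ', hv⟩]
      unfold blockWeight
      ring
    · rw [if_neg (fun h => hv h.2)]
      have hz : g (n + k) (Fin.append β' v) = 0 := by
        by_contra h
        exact hv fun i => by simpa using hsupp _ _ h (Fin.natAdd n i)
      rw [hz, zero_div, mul_zero, mul_zero, mul_zero]
  simp only [hstep1]
  rw [← Finset.mul_sum]
  congr 1
  -- Step 2: (Tzero) replaces `𝓛_{1-γ}` by `𝓛_2`
  have hmeas : ∀ (c : ℝ) k, Measurable fun v : Fin k → ℝ =>
      linnikFn c v univ * (g (n + k) (Fin.append β' v) / ∏ i, v i) := fun c k =>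
    (measurable_linnikFn c univ).mul (((hgm _).comp (measurable_append_right β')).div
      (Finset.measurable_prod _ fun i _ => measurable_pi_apply i))
  have hbd : ∀ (c : ℝ) k (v : Fin k → ℝ),
      |linnikFn c v univ * (g (n + k) (Fin.append β' v) / ∏ i, v i)| ≤ k * (2 ^ k) ^ k * (Gb / η ^ k) := by
    intro c k v
    rw [abs_mul]
    have h1 := abs_linnikFn_le c v univ
    simp only [Fintype.card_fin] at h1
    exact mul_le_mul h1 (abs_div_prod_le_of_support hη hGb hsupp β' v) (abs_nonneg _) (by positivity)
  have hsub : ∀ k, sliceIntegral k α (fun v => (linnikFn 2 v univ - linnikFn (1 - γ) v univ) *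
      (g (n + k) (Fin.append β' v) / ∏ i, v i)) =
      sliceIntegral k α (fun v => linnikFn 2 v univ * (g (n + k) (Fin.append β' v) / ∏ i, v i)) -
      sliceIntegral k α (fun v => linnikFn (1 - γ) v univ * (g (n + k) (Fin.append β' v) / ∏ i, v i)) := by
    intro k
    have hpt : (fun v : Fin k → ℝ => (linnikFn 2 v univ - linnikFn (1 - γ) v univ) *
        (g (n + k) (Fin.append β' v) / ∏ i, v i)) = fun v =>
        linnikFn 2 v univ * (g (n + k) (Fin.append β' v) / ∏ i, v i) +
          (-1 : ℝ) * (linnikFn (1 - γ) v univ * (g (n + k) (Fin.append β' v) / ∏ i, v i)) := by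
      funext v; ring
    rw [hpt, sliceIntegral_add' k α (hmeas 2 k) ((hmeas (1 - γ) k).const_mul _)
      (C := k * (2 ^ k) ^ k * (Gb / η ^ k)) (hbd 2 k)
      (fun v => by rw [abs_mul]; simpa using hbd (1 - γ) k v), sliceIntegral_const_mul]
    ring
  have hT' := hT n β' α
  simp only [hsub, mul_sub, Finset.sum_sub_distrib, sub_eq_zero] at hT'
  rw [← hT']
  -- Step 3: with `𝓛_2` only `k = 1` survives
  rw [Finset.sum_eq_single_of_mem 1 (Finset.mem_Icc.2 ⟨le_rfl, hN⟩)]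
  · rw [Nat.factorial_one, Nat.cast_one, div_one, one_mul, sliceIntegral_one, if_pos hαpos]
    have hL : linnikFn 2 (fun _ : Fin 1 => α) univ = 1 := by
      rw [linnikFn_eq_of_sum_lt 2 _ (Finset.univ_nonempty_iff.2 ⟨0⟩) (fun _ _ => hαpos.le)
        (by simp; linarith)]
      simp
    rw [hL, one_mul, Fin.prod_univ_one, Fin.append_right_eq_snoc]
  · intro k hk hk1
    have hk2 : 2 ≤ k := by
      have := (Finset.mem_Icc.1 hk).1
      omega
    have : sliceIntegral k α (fun v => linnikFn 2 v univ * (g (n + k) (Fin.append β' v) / ∏ i, v i)) =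
        sliceIntegral k α (fun _ => 0) := by
      refine sliceIntegral_congr fun v hv hsum => ?_
      rw [linnikFn_eq_of_sum_lt 2 v (Finset.univ_nonempty_iff.2 ⟨⟨0, by omega⟩⟩) (fun i _ => (hv i).le)
        (by rw [hsum]; linarith)]
      rw [if_neg (by simp only [Finset.card_univ, Fintype.card_fin]; omega), zero_mul]
    rw [this, sliceIntegral_zero, mul_zero]

/-! ### Peeling the last block of the iterated integrand -/

/-- The iterated integrand of (6.3) peels its last block: the admissibility condition, the
product of weights (`prod_blockWeight_append`) and the argument of `g` split into the first `m`
blocks `β'` and the last block `v`. [cite: FordMaynard2024PrimeSieves, §6.1 (6.3)] -/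
theorem fragH_peel (γ η : ℝ) (g : VecFn) {m : ℕ} (kv : Fin (m + 1) → ℕ) (ξ : Fin (m + 1) → ℝ) :
    multiSlice (m + 1) kv ξ (fun β => if ∀ t, η ≤ β t then
        (∏ j, blockWeight γ (kv j) (fun i =>
            β (Fin.cast (bsum_eq_sum (m + 1) kv).symm (finSigmaFinEquiv (n := kv) ⟨j, i⟩)))) *
          g (∑ j, kv j) (β ∘ Fin.cast (bsum_eq_sum (m + 1) kv).symm) else 0) =
      multiSlice m (Fin.init kv) (Fin.init ξ) (fun β' => sliceIntegral (kv (Fin.last m)) (ξ (Fin.last m))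
        (fun v => if (∀ t, η ≤ β' t) ∧ (∀ i, η ≤ v i) then
          (∏ j : Fin m, blockWeight γ (Fin.init kv j) (fun i =>
              β' (Fin.cast (bsum_eq_sum m (Fin.init kv)).symm (finSigmaFinEquiv (n := Fin.init kv) ⟨j, i⟩)))) *
            blockWeight γ (kv (Fin.last m)) v *
            g (bsum m (Fin.init kv) + kv (Fin.last m)) (Fin.append β' v) else 0)) := by
  rw [multiSlice_succ]
  refine multiSlice_congr m _ _ fun β' => ?_
  congr 1
  funext v
  have hiff : (∀ t : Fin (bsum (m + 1) kv), η ≤ Fin.append β' v t) ↔ (∀ t, η ≤ β' t) ∧ ∀ i, η ≤ v i := by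
    constructor
    · intro h
      refine ⟨fun t => ?_, fun i => ?_⟩
      · have := h (Fin.castAdd (kv (Fin.last m)) t)
        rwa [Fin.append_left] at this
      · have := h (Fin.natAdd (bsum m (Fin.init kv)) i)
        rwa [Fin.append_right] at this
    · intro h t
      refine Fin.addCases (fun l => ?_) (fun r => ?_) t
      · rw [Fin.append_left]; exact h.1 l
      · rw [Fin.append_right]; exact h.2 r
  by_cases hc : (∀ t, η ≤ β' t) ∧ ∀ i, η ≤ v i
  · rw [if_pos (hiff.2 hc), if_pos hc, prod_blockWeight_append]
    congr 1
    exact VecFn.apply_congr g (bsum_eq_sum (m + 1) kv).symm _ _ fun i => rfl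
  · rw [if_neg (fun h => hc (hiff.1 h)), if_neg hc]

/-! ### The fragmentation identity for the class, by induction on the number of blocks -/

/-- **The fragmentation identity (6.3) for functions satisfying (Tzero).** Let `0 < η`,
`N = ⌊1/η⌋ ≥ 1`, and let `g` be symmetric, measurable, bounded, supported on vectors with entries
`≥ η`, and satisfy the one-block identity (Tzero) truncated at `N`. Then for every `ξ ∈ ℝ^m` with
`η ≤ ξ_j ≤ 1`:
`g(ξ) = ξ₁⋯ξ_m ∑_{1 ≤ k_j ≤ N} multiSlice m k ξ (β ↦ 𝟙[β ≥ η] ∏_j w_{k_j}(β_j) g(β))`.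
Induction on `m`, the class being stable under `g ↦ g(·, ξ_m)`.
[cite: FordMaynard2024PrimeSieves, §6.1 (proof of Theorem 6.4, (TypeI-f) ⇒ (6.3))] -/
theorem frag_identity (hη : 0 < η) (hN : 1 ≤ maxBlock η) :
    ∀ (m : ℕ) (g : VecFn), g.IsSymmetric → (∀ n, Measurable (g n)) → ∀ {Gb : ℝ}, (∀ n v, |g n v| ≤ Gb) →
      (∀ n v, g n v ≠ 0 → ∀ i, η ≤ v i) →
      (∀ (r : ℕ) (y : Fin r → ℝ) (t : ℝ), ∑ k ∈ Finset.Icc 1 (maxBlock η), (1 / (k.factorial : ℝ)) *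
        sliceIntegral k t (fun u => (linnikFn 2 u univ - linnikFn (1 - γ) u univ) *
          (g (r + k) (Fin.append y u) / ∏ i, u i)) = 0) →
      ∀ ξ : Fin m → ℝ, (∀ j, η ≤ ξ j) → (∀ j, ξ j ≤ 1) →
        g m ξ = (∏ j, ξ j) *
          ∑ kv ∈ Fintype.piFinset (fun _ : Fin m => Finset.Icc 1 (maxBlock η)),
            multiSlice m kv ξ (fun β => if ∀ t, η ≤ β t then
              (∏ j, blockWeight γ (kv j) (fun i =>
                  β (Fin.cast (bsum_eq_sum m kv).symm (finSigmaFinEquiv (n := kv) ⟨j, i⟩)))) *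
                g (∑ j, kv j) (β ∘ Fin.cast (bsum_eq_sum m kv).symm) else 0)
  | 0, g, _, _, Gb, _, _, _, ξ, _, _ => by
    have huniv : Fintype.piFinset (fun _ : Fin 0 => Finset.Icc 1 (maxBlock η)) = Finset.univ :=
      Finset.eq_univ_of_forall fun kv => Fintype.mem_piFinset.2 fun j => j.elim0
    rw [huniv, Fintype.sum_unique, multiSlice_zero]
    simp only [Finset.univ_eq_empty, Finset.prod_empty, one_mul]
    split_ifs with hc
    · refine (VecFn.apply_congr g ?_ _ ξ fun i => ?_).symm
      · simp
      · exact (Fin.cast (by simp) i : Fin 0).elim0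
    · exact absurd (fun t => t.elim0) hc
  | m + 1, g, hs, hgm, Gb, hGb, hsupp, hT, ξ, hξ, hξ1 => by
    -- the last coordinate and the frozen function
    have hα : η ≤ ξ (Fin.last m) := hξ _
    have hα1 : ξ (Fin.last m) ≤ 1 := hξ1 _
    have hαpos : 0 < ξ (Fin.last m) := hη.trans_le hα
    have hG0 : 0 ≤ Gb := (abs_nonneg _).trans (hGb 0 Fin.elim0)
    set g' : VecFn := fun n β => g (n + 1) (Fin.snoc (α := fun _ => ℝ) β (ξ (Fin.last m))) with hg'
    have hs' : g'.IsSymmetric := by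
      intro n σ β
      show g (n + 1) (Fin.snoc (α := fun _ => ℝ) (β ∘ σ) (ξ (Fin.last m))) =
        g (n + 1) (Fin.snoc (α := fun _ => ℝ) β (ξ (Fin.last m)))
      rw [Fin.snoc_eq_append, Fin.snoc_eq_append]
      exact hs.append_perm_left β _ σ
    have hgm' : ∀ n, Measurable (g' n) := fun n =>
      (hgm (n + 1)).comp (measurable_snoc.comp (measurable_id.prodMk measurable_const))
    have hGb' : ∀ n v, |g' n v| ≤ Gb := fun n v => hGb _ _
    have hsupp' : ∀ n v, g' n v ≠ 0 → ∀ i, η ≤ v i := by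
      intro n v h i
      have := hsupp _ _ h (Fin.castSucc i)
      simpa using this
    have hT' := oneBlockFrag_snoc (γ := γ) hs (maxBlock η) hT (ξ (Fin.last m))
    -- induction hypothesis for `g'` at `init ξ`
    have IH := frag_identity hη hN m g' hs' hgm' hGb' hsupp' hT' (Fin.init ξ)
      (fun j => hξ _) (fun j => hξ1 _)
    -- peel the last block
    rw [Finset.sum_congr rfl fun kv _ => fragH_peel γ η g kv ξ]
    rw [sum_piFinset_init_last (Finset.Icc 1 (maxBlock η)) (fun kv' k =>
      multiSlice m kv' (Fin.init ξ) (fun β' => sliceIntegral k (ξ (Fin.last m))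
        (fun v => if (∀ t, η ≤ β' t) ∧ (∀ i, η ≤ v i) then
          (∏ j : Fin m, blockWeight γ (kv' j) (fun i =>
              β' (Fin.cast (bsum_eq_sum m kv').symm (finSigmaFinEquiv (n := kv') ⟨j, i⟩)))) *
            blockWeight γ k v * g (bsum m kv' + k) (Fin.append β' v) else 0)))]
    -- the sum over the size of the last block, inside the iterated integral
    have hinner : ∀ kv' ∈ Fintype.piFinset (fun _ : Fin m => Finset.Icc 1 (maxBlock η)),
        ∑ k ∈ Finset.Icc 1 (maxBlock η), multiSlice m kv' (Fin.init ξ) (fun β' =>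
          sliceIntegral k (ξ (Fin.last m)) (fun v => if (∀ t, η ≤ β' t) ∧ (∀ i, η ≤ v i) then
            (∏ j : Fin m, blockWeight γ (kv' j) (fun i =>
                β' (Fin.cast (bsum_eq_sum m kv').symm (finSigmaFinEquiv (n := kv') ⟨j, i⟩)))) *
              blockWeight γ k v * g (bsum m kv' + k) (Fin.append β' v) else 0)) =
        (1 / ξ (Fin.last m)) * multiSlice m kv' (Fin.init ξ) (fun β' => if ∀ t, η ≤ β' t then
          (∏ j, blockWeight γ (kv' j) (fun i =>
              β' (Fin.cast (bsum_eq_sum m kv').symm (finSigmaFinEquiv (n := kv') ⟨j, i⟩)))) *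
            g' (∑ j, kv' j) (β' ∘ Fin.cast (bsum_eq_sum m kv').symm) else 0) := by
      intro kv' _
      -- the weight of the first `m` blocks
      have hWm : Measurable fun β' : Fin (bsum m kv') → ℝ => ∏ j, blockWeight γ (kv' j) (fun i =>
          β' (Fin.cast (bsum_eq_sum m kv').symm (finSigmaFinEquiv (n := kv') ⟨j, i⟩))) :=
        Finset.measurable_prod _ fun j _ => (measurable_blockWeight γ (kv' j)).comp
          (measurable_pi_iff.2 fun i => measurable_pi_apply _)
      set Wb : ℝ := ∏ j, ((kv' j : ℝ) * (2 ^ kv' j) ^ kv' j / η ^ kv' j) with hWb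
      have hWb0 : 0 ≤ Wb := Finset.prod_nonneg fun j _ => by positivity
      have hWle : ∀ β' : Fin (bsum m kv') → ℝ, (∀ t, η ≤ β' t) →
          |∏ j, blockWeight γ (kv' j) (fun i =>
            β' (Fin.cast (bsum_eq_sum m kv').symm (finSigmaFinEquiv (n := kv') ⟨j, i⟩)))| ≤ Wb := by
        intro β' hβ'
        rw [Finset.abs_prod]
        exact Finset.prod_le_prod (fun j _ => abs_nonneg _) fun j _ =>
          abs_blockWeight_le hη (kv' j) _ fun i => hβ' _
      -- linearity of `multiSlice` in the size of the last block
      rw [← multiSlice_sum' (Finset.Icc 1 (maxBlock η)) m kv' (Fin.init ξ) _ ?_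
        (C := fun k => Wb * (k * (2 ^ k) ^ k / η ^ k) * Gb * max (ξ (Fin.last m)) 1 ^ k) ?_]
      rotate_left
      · intro k _
        refine measurable_sliceIntegral_param (X := Fin (bsum m kv') → ℝ) k measurable_const ?_
        refine Measurable.ite ?_ ?_ measurable_const
        · refine MeasurableSet.inter ?_ ?_
          · refine (Measurable.forall fun t => ?_).setOf
            have hm1 : Measurable fun q : (Fin (bsum m kv') → ℝ) × (Fin k → ℝ) => q.1 t :=
              (measurable_pi_apply t).comp measurable_fst
            exact measurableSet_setOf.1 (measurableSet_le measurable_const hm1)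
          · refine (Measurable.forall fun i => ?_).setOf
            have hm2 : Measurable fun q : (Fin (bsum m kv') → ℝ) × (Fin k → ℝ) => q.2 i :=
              (measurable_pi_apply i).comp measurable_snd
            exact measurableSet_setOf.1 (measurableSet_le measurable_const hm2)
        · exact ((hWm.comp measurable_fst).mul ((measurable_blockWeight γ k).comp measurable_snd)).mul
            ((hgm _).comp measurable_finAppend)
      · intro k _ β'
        refine abs_sliceIntegral_le_pow k (le_max_right _ _) (le_max_left _ _) (by positivity) fun v => ?_
        split_ifs with hc
        · rw [abs_mul, abs_mul]
          exact mul_le_mul (mul_le_mul (hWle β' hc.1) (abs_blockWeight_le hη k v hc.2) (abs_nonneg _) hWb0)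
            (hGb _ _) (abs_nonneg _) (by positivity)
        · rw [abs_zero]; positivity
      -- evaluate the inner sum by (Tzero) for `g`
      rw [← multiSlice_const_mul]
      refine multiSlice_congr m _ _ fun β' => ?_
      by_cases hβ' : ∀ t, η ≤ β' t
      · rw [inner_block_sum_eq (γ := γ) hη hgm hGb hsupp hN hT β' hβ' _ hα hα1, if_pos hβ']
        have hgg : g' (∑ j, kv' j) (β' ∘ Fin.cast (bsum_eq_sum m kv').symm) =
            g (bsum m kv' + 1) (Fin.snoc (α := fun _ => ℝ) β' (ξ (Fin.last m))) := by
          show g ((∑ j, kv' j) + 1) (Fin.snoc (α := fun _ => ℝ) (β' ∘ Fin.cast (bsum_eq_sum m kv').symm)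
            (ξ (Fin.last m))) = _
          rw [snoc_comp_cast]
          exact VecFn.apply_congr g (by rw [bsum_eq_sum]) _ _ fun i => rfl
        rw [hgg]
        field_simp
      · rw [if_neg hβ', mul_zero]
        refine Finset.sum_eq_zero fun k _ => ?_
        have : (fun v : Fin k → ℝ => if (∀ t, η ≤ β' t) ∧ (∀ i, η ≤ v i) then
            (∏ j : Fin m, blockWeight γ (kv' j) (fun i =>
                β' (Fin.cast (bsum_eq_sum m kv').symm (finSigmaFinEquiv (n := kv') ⟨j, i⟩)))) *
              blockWeight γ k v * g (bsum m kv' + k) (Fin.append β' v) else 0) = fun _ => 0 := by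
          funext v
          rw [if_neg (fun h => hβ' h.1)]
        rw [this, sliceIntegral_zero]
    rw [Finset.sum_congr rfl hinner, ← Finset.mul_sum]
    -- the induction hypothesis
    have hprod' : 0 < ∏ j, Fin.init ξ j := Finset.prod_pos fun j _ => hη.trans_le (hξ _)
    have hS : ∑ kv' ∈ Fintype.piFinset (fun _ : Fin m => Finset.Icc 1 (maxBlock η)),
        multiSlice m kv' (Fin.init ξ) (fun β' => if ∀ t, η ≤ β' t then
          (∏ j, blockWeight γ (kv' j) (fun i =>
              β' (Fin.cast (bsum_eq_sum m kv').symm (finSigmaFinEquiv (n := kv') ⟨j, i⟩)))) *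
            g' (∑ j, kv' j) (β' ∘ Fin.cast (bsum_eq_sum m kv').symm) else 0) =
        g' m (Fin.init ξ) / ∏ j, Fin.init ξ j := by
      rw [eq_div_iff hprod'.ne', mul_comm, ← IH]
    rw [hS]
    have hlast : g' m (Fin.init ξ) = g (m + 1) ξ := by
      show g (m + 1) (Fin.snoc (α := fun _ => ℝ) (Fin.init ξ) (ξ (Fin.last m))) = g (m + 1) ξ
      rw [Fin.snoc_init_self]
    rw [hlast, Fin.prod_univ_castSucc]
    have hP : (∏ i : Fin m, ξ (Fin.castSucc i)) ≠ 0 := by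
      have := hprod'
      simp only [Fin.init] at this
      exact this.ne'
    have hA : ξ (Fin.last m) ≠ 0 := hαpos.ne'
    simp only [Fin.init]
    field_simp

/-! ### (TypeI-f) implies the fragmentation relation -/

/-- **Theorem 6.4, forward direction: (TypeI-f) ⇒ (6.3).** For `0 < η`, `γ < 1` and
`f ∈ 𝔉*_η(γ)` (symmetric, bounded, supported on vectors with entries `≥ η` summing to `1`,
piecewise Lipschitz, satisfying (TypeI-f)), `f` satisfies the fragmentation relation
`FragRel γ η f`: `f(ξ) = fragOp γ η f (ξ)` for all `ξ ≥ η` with `|ξ| = 1`.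
[cite: FordMaynard2024PrimeSieves, Theorem 6.4] -/
theorem MemTypeIStar.fragRel {f : VecFn} (hf : MemTypeIStar η γ f) (hη : 0 < η) (hγ1 : γ < 1) :
    FragRel γ η f := by
  intro m ξ hξ hsum
  obtain ⟨Fb, hFb⟩ := hf.bounded
  have hfm : ∀ k, Measurable (f k) := fun k => (hf.piecewiseLipschitz k).measurable
  rcases Nat.eq_zero_or_pos m with rfl | hm
  · simp at hsum
  have hpos : ∀ i, 0 < ξ i := fun i => hη.trans_le (hξ i)
  have hξ1 : ∀ j, ξ j ≤ 1 := fun j => by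
    rw [← hsum]
    exact Finset.single_le_sum (fun i _ => (hpos i).le) (Finset.mem_univ j)
  have hη1 : η ≤ 1 := (hξ ⟨0, hm⟩).trans (hξ1 _)
  have hN : 1 ≤ maxBlock η := by
    unfold maxBlock
    refine Nat.le_floor ?_
    rw [Nat.cast_one, le_div_iff₀ hη]
    linarith
  rw [fragOp_eq_multiSlice hη f hfm hFb m ξ]
  exact frag_identity hη hN m f hf.symm hfm hFb (fun n v h => (hf.support n v h).1)
    (fun r y t => hf.oneBlockFrag_eq_zero hη hγ1 hfm y t le_rfl) ξ hξ hξ1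

end Forward

end Literature.NumberTheory.Sieve.FordMaynard
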